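import Literature.NumberTheory.CubicFields.CubicFieldDiscriminant13283Primes
import HarnessLib

/-!
# The cubic field of discriminant `−13283` (LMFDB 3.1.13283.1), part 3: the primes above `17 ≤ p ≤ 31` are principal; CLASS NUMBER ONE — PROVED

Sequel of `CubicFieldDiscriminant13283Primes.lean` (part 2: `θ`-relation and the primes above `p ≤ 13`) and `CubicFieldDiscriminant13283.lean` (same seat, same namespace `Literature.NumberTheory.CubicFields.CubicDisc13283`; §1–§2 there: the polynomial,
`d_F = −13283`, `𝓞_F = ℤ[θ]`, signature).  THEOREMS ONLY; every statement PROVED.  §3: every prime of `𝓞_F` above `p ≤ 32` with `p^f ≤ 32` is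
principal (explicit generators / inert primes, Dedekind–Kummer); §4: ★ `h_F = 1` by Minkowski (`(4/π)(3!/3³)√13283 ≈ 32.61 < 33`) and
`not_two_dvd_classNumber`.  Written by the prover seat `bsd-line-att-p4` g38 (cell `bsd-f1-sign2`; g27's template) for the curve `[1,0,0,−13,−20]` of conductor
`13283 = 37·359` on the doors-dead sub-cell (u1/u7) of crux C2 — the datum «`h(ℚ(β)) = 1`» of att-p3's / att-p5's class-group doors.

References: [LMFDB] number field 3.1.13283.1 (class number 1); [Marcus2018] Ch. 3 Thm. 27, Ch. 5 Thm. 37 and Cor. 2.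
-/

noncomputable section

open Polynomial NumberField NumberField.InfinitePlace Ideal Module Real
open Literature.NumberTheory.NumberFields
open Literature.NumberTheory.NumberFields.MonicCubic

namespace Literature.NumberTheory.CubicFields.CubicDisc13283

section NumberField

variable {F : Type*} [Field F] [NumberField F] {α : F}

/-- The cubic relation `θ³ + aθ² + bθ + c = 0` in `𝓞_F`, numerals pushed (private helper). [folklore] -/
private theorem theta_rel' (hα : aeval α (poly (40) (28) (5)) = 0) :
    thetaInt hα ^ 3 + (40) * thetaInt hα ^ 2 + (28) * thetaInt hα + (5) = 0 := by
  have h := thetaInt_rel hα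
  push_cast at h
  linear_combination h

/-- `(17, θ + 14) = (-2 - 5 * θ)` (an element of norm `±17`). [cite: Marcus2018, Ch. 3, Thm. 27] -/
theorem span_17_lin14_eq (hα : aeval α (poly (40) (28) (5)) = 0) :
    span {(17 : 𝓞 F), thetaInt hα + 14} = span {-2 - 5 * thetaInt hα} := by
  have hrel := theta_rel' hα
  apply le_antisymm
  · rw [span_le]
    rintro x hx
    rcases hx with rfl | hx
    · exact mem_span_singleton'.mpr ⟨304 + 990 * thetaInt hα + 25 * thetaInt hα ^ 2, by linear_combination (-125) * hrel⟩
    · rw [Set.mem_singleton_iff.mp hx]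
      exact mem_span_singleton'.mpr ⟨243 + 792 * thetaInt hα + 20 * thetaInt hα ^ 2, by linear_combination (-100) * hrel⟩
  · rw [span_singleton_le_iff_mem, mem_span_pair]
    exact ⟨5 - 13 * thetaInt hα - 8 * thetaInt hα ^ 2, -8 + 6 * thetaInt hα - 5 * thetaInt hα ^ 2, by linear_combination (-5) * hrel⟩

/-- **Every prime of `𝓞_F` above `17` with `17^f ≤ 32` is principal** (Dedekind–Kummer with `polyMod_17` and the generators above).
[cite: Marcus2018, Ch. 3, Thm. 27] [cite: LMFDB, number field 3.1.13283.1 (class number 1)] -/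
theorem isPrincipal_of_mem_primesOver_17 (h3 : finrank ℚ F = 3) (hα : aeval α (poly (40) (28) (5)) = 0) {P : Ideal (𝓞 F)}
    (hP : P ∈ primesOver (span {((17 : ℕ) : ℤ)}) (𝓞 F))
    (hle : 17 ^ P.inertiaDeg ℤ ≤ 32) : Submodule.IsPrincipal P := by
  haveI : Fact (Nat.Prime 17) := ⟨by norm_num⟩
  obtain ⟨Qb, hirr, hmon, hdvd, hdeg, hspan⟩ :=
    exists_factor_of_mem_primesOver irreducible_polyQ hα h3 isUnit_of_disc_eq_sq_mul (by norm_num : Nat.Prime 17) hP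
  rw [polyMod_17] at hdvd
  rcases hirr.prime.dvd_or_dvd hdvd with h | h
  · have hirr1 : Irreducible (X + 14 : (ZMod 17)[X]) := by
      rw [show (X + 14 : (ZMod 17)[X]) = X - C (-14) by rw [map_neg, map_ofNat]; ring]
      exact irreducible_X_sub_C _
    have hQb : Qb = X + 14 := eq_of_monic_of_associated hmon (by monicity!) (hirr.associated_of_dvd hirr1 h)
    have hPeq := hspan (X + C 14) (by rw [hQb]; simp [map_ofNat])
    rw [show aeval (thetaInt hα) (X + C 14 : ℤ[X]) = thetaInt hα + 14 by
        simp only [map_add, aeval_X, aeval_C, algebraMap_int_eq, Int.coe_castRingHom, Int.cast_ofNat], Nat.cast_ofNat, span_17_lin14_eq hα] at hPeq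
    exact ⟨⟨-2 - 5 * thetaInt hα, by rw [hPeq, Ideal.submodule_span_eq]⟩⟩
  · have hQb : Qb = X ^ 2 + 9 * X + 4 :=
      eq_of_monic_of_associated hmon (by monicity!) (hirr.associated_of_dvd irreducible_quad_17 h)
    exfalso
    have hd2 : (X ^ 2 + 9 * X + 4 : (ZMod 17)[X]).natDegree = 2 := by compute_degree!
    rw [hdeg, hQb, hd2] at hle
    norm_num at hle

/-- `f` has no root modulo `19`: `19` is inert. [cite: Marcus2018, Ch. 3, Thm. 27] -/
theorem no_root_19' : ∀ r : ZMod 19, r ^ 3 + ((40 : ℤ) : ZMod 19) * r ^ 2 + ((28 : ℤ) : ZMod 19) * r + ((5 : ℤ) : ZMod 19) ≠ 0 := by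
  decide

/-- **Every prime of `𝓞_F` above `19` is principal**: `19` is inert, the prime is `(19)`. [cite: Marcus2018, Ch. 3, Thm. 27] -/
theorem isPrincipal_of_mem_primesOver_19 (h3 : finrank ℚ F = 3) (hα : aeval α (poly (40) (28) (5)) = 0) {P : Ideal (𝓞 F)}
    (hP : P ∈ primesOver (span {((19 : ℕ) : ℤ)}) (𝓞 F)) : Submodule.IsPrincipal P := by
  have hPeq := eq_span_of_no_root irreducible_polyQ hα h3 isUnit_of_disc_eq_sq_mul (by norm_num : Nat.Prime 19) hP no_root_19'
  exact ⟨⟨((19 : ℕ) : 𝓞 F), by rw [hPeq, Ideal.submodule_span_eq]⟩⟩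

/-- `(23, θ + 7) = (138 + 475 * θ + 12 * θ ^ 2)` (an element of norm `±23`). [cite: Marcus2018, Ch. 3, Thm. 27] -/
theorem span_23_lin7_eq (hα : aeval α (poly (40) (28) (5)) = 0) :
    span {(23 : 𝓞 F), thetaInt hα + 7} = span {138 + 475 * thetaInt hα + 12 * thetaInt hα ^ 2} := by
  have hrel := theta_rel' hα
  apply le_antisymm
  · rw [span_le]
    rintro x hx
    rcases hx with rfl | hx
    · exact mem_span_singleton'.mpr ⟨-4 - 10 * thetaInt hα - thetaInt hα ^ 2, by linear_combination (-115 - 12 * thetaInt hα) * hrel⟩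
    · rw [Set.mem_singleton_iff.mp hx]
      exact mem_span_singleton'.mpr ⟨-1 - 2 * thetaInt hα + thetaInt hα ^ 2, by linear_combination (-29 + 12 * thetaInt hα) * hrel⟩
  · rw [span_singleton_le_iff_mem, mem_span_pair]
    exact ⟨10 + 26 * thetaInt hα + 5 * thetaInt hα ^ 2, -11 - 4 * thetaInt hα + 3 * thetaInt hα ^ 2, by linear_combination (3) * hrel⟩

/-- **Every prime of `𝓞_F` above `23` with `23^f ≤ 32` is principal** (Dedekind–Kummer with `polyMod_23` and the generators above).
[cite: Marcus2018, Ch. 3, Thm. 27] [cite: LMFDB, number field 3.1.13283.1 (class number 1)] -/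
theorem isPrincipal_of_mem_primesOver_23 (h3 : finrank ℚ F = 3) (hα : aeval α (poly (40) (28) (5)) = 0) {P : Ideal (𝓞 F)}
    (hP : P ∈ primesOver (span {((23 : ℕ) : ℤ)}) (𝓞 F))
    (hle : 23 ^ P.inertiaDeg ℤ ≤ 32) : Submodule.IsPrincipal P := by
  haveI : Fact (Nat.Prime 23) := ⟨by norm_num⟩
  obtain ⟨Qb, hirr, hmon, hdvd, hdeg, hspan⟩ :=
    exists_factor_of_mem_primesOver irreducible_polyQ hα h3 isUnit_of_disc_eq_sq_mul (by norm_num : Nat.Prime 23) hP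
  rw [polyMod_23] at hdvd
  rcases hirr.prime.dvd_or_dvd hdvd with h | h
  · have hirr1 : Irreducible (X + 7 : (ZMod 23)[X]) := by
      rw [show (X + 7 : (ZMod 23)[X]) = X - C (-7) by rw [map_neg, map_ofNat]; ring]
      exact irreducible_X_sub_C _
    have hQb : Qb = X + 7 := eq_of_monic_of_associated hmon (by monicity!) (hirr.associated_of_dvd hirr1 h)
    have hPeq := hspan (X + C 7) (by rw [hQb]; simp [map_ofNat])
    rw [show aeval (thetaInt hα) (X + C 7 : ℤ[X]) = thetaInt hα + 7 by
        simp only [map_add, aeval_X, aeval_C, algebraMap_int_eq, Int.coe_castRingHom, Int.cast_ofNat], Nat.cast_ofNat, span_23_lin7_eq hα] at hPeq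
    exact ⟨⟨138 + 475 * thetaInt hα + 12 * thetaInt hα ^ 2, by rw [hPeq, Ideal.submodule_span_eq]⟩⟩
  · have hQb : Qb = X ^ 2 + 10 * X + 4 :=
      eq_of_monic_of_associated hmon (by monicity!) (hirr.associated_of_dvd irreducible_quad_23 h)
    exfalso
    have hd2 : (X ^ 2 + 10 * X + 4 : (ZMod 23)[X]).natDegree = 2 := by compute_degree!
    rw [hdeg, hQb, hd2] at hle
    norm_num at hle

/-- `f` has no root modulo `29`: `29` is inert. [cite: Marcus2018, Ch. 3, Thm. 27] -/
theorem no_root_29' : ∀ r : ZMod 29, r ^ 3 + ((40 : ℤ) : ZMod 29) * r ^ 2 + ((28 : ℤ) : ZMod 29) * r + ((5 : ℤ) : ZMod 29) ≠ 0 := by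
  decide

/-- **Every prime of `𝓞_F` above `29` is principal**: `29` is inert, the prime is `(29)`. [cite: Marcus2018, Ch. 3, Thm. 27] -/
theorem isPrincipal_of_mem_primesOver_29 (h3 : finrank ℚ F = 3) (hα : aeval α (poly (40) (28) (5)) = 0) {P : Ideal (𝓞 F)}
    (hP : P ∈ primesOver (span {((29 : ℕ) : ℤ)}) (𝓞 F)) : Submodule.IsPrincipal P := by
  have hPeq := eq_span_of_no_root irreducible_polyQ hα h3 isUnit_of_disc_eq_sq_mul (by norm_num : Nat.Prime 29) hP no_root_29'
  exact ⟨⟨((29 : ℕ) : 𝓞 F), by rw [hPeq, Ideal.submodule_span_eq]⟩⟩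

/-- `(31, θ + 25) = (404 + 1189 * θ + 30 * θ ^ 2)` (an element of norm `±31`). [cite: Marcus2018, Ch. 3, Thm. 27] -/
theorem span_31_lin25_eq (hα : aeval α (poly (40) (28) (5)) = 0) :
    span {(31 : 𝓞 F), thetaInt hα + 25} = span {404 + 1189 * thetaInt hα + 30 * thetaInt hα ^ 2} := by
  have hrel := theta_rel' hα
  apply le_antisymm
  · rw [span_le]
    rintro x hx
    rcases hx with rfl | hx
    · exact mem_span_singleton'.mpr ⟨-6 - 16 * thetaInt hα + thetaInt hα ^ 2, by linear_combination (-491 + 30 * thetaInt hα) * hrel⟩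
    · rw [Set.mem_singleton_iff.mp hx]
      exact mem_span_singleton'.mpr ⟨-5 - 14 * thetaInt hα - thetaInt hα ^ 2, by linear_combination (-409 - 30 * thetaInt hα) * hrel⟩
  · rw [span_singleton_le_iff_mem, mem_span_pair]
    exact ⟨24 + 43 * thetaInt hα - 2 * thetaInt hα ^ 2, -15 - 13 * thetaInt hα - 7 * thetaInt hα ^ 2, by linear_combination (-7) * hrel⟩

/-- `(31, θ + 8) = (-1 - 4 * θ)` (an element of norm `±31`). [cite: Marcus2018, Ch. 3, Thm. 27] -/
theorem span_31_lin8_eq (hα : aeval α (poly (40) (28) (5)) = 0) :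
    span {(31 : 𝓞 F), thetaInt hα + 8} = span {-1 - 4 * thetaInt hα} := by
  have hrel := theta_rel' hα
  apply le_antisymm
  · rw [span_le]
    rintro x hx
    rcases hx with rfl | hx
    · exact mem_span_singleton'.mpr ⟨289 + 636 * thetaInt hα + 16 * thetaInt hα ^ 2, by linear_combination (-64) * hrel⟩
    · rw [Set.mem_singleton_iff.mp hx]
      exact mem_span_singleton'.mpr ⟨72 + 159 * thetaInt hα + 4 * thetaInt hα ^ 2, by linear_combination (-16) * hrel⟩
  · rw [span_singleton_le_iff_mem, mem_span_pair]
    exact ⟨4 + thetaInt hα + thetaInt hα ^ 2, -15 + thetaInt hα + thetaInt hα ^ 2, by linear_combination (1) * hrel⟩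

/-- `(31, θ + 7) = (14 + 40 * θ + θ ^ 2)` (an element of norm `±31`). [cite: Marcus2018, Ch. 3, Thm. 27] -/
theorem span_31_lin7_eq (hα : aeval α (poly (40) (28) (5)) = 0) :
    span {(31 : 𝓞 F), thetaInt hα + 7} = span {14 + 40 * thetaInt hα + thetaInt hα ^ 2} := by
  have hrel := theta_rel' hα
  apply le_antisymm
  · rw [span_le]
    rintro x hx
    rcases hx with rfl | hx
    · exact mem_span_singleton'.mpr ⟨-196 - 555 * thetaInt hα - 14 * thetaInt hα ^ 2, by linear_combination (-555 - 14 * thetaInt hα) * hrel⟩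
    · rw [Set.mem_singleton_iff.mp hx]
      exact mem_span_singleton'.mpr ⟨-42 - 119 * thetaInt hα - 3 * thetaInt hα ^ 2, by linear_combination (-119 - 3 * thetaInt hα) * hrel⟩
  · rw [span_singleton_le_iff_mem, mem_span_pair]
    exact ⟨4 + 2 * thetaInt hα + thetaInt hα ^ 2, -15 + 3 * thetaInt hα + thetaInt hα ^ 2, by linear_combination (1) * hrel⟩

/-- **Every prime of `𝓞_F` above `31` is principal** (Dedekind–Kummer with `polyMod_31` and the generators above).
[cite: Marcus2018, Ch. 3, Thm. 27] [cite: LMFDB, number field 3.1.13283.1 (class number 1)] -/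
theorem isPrincipal_of_mem_primesOver_31 (h3 : finrank ℚ F = 3) (hα : aeval α (poly (40) (28) (5)) = 0) {P : Ideal (𝓞 F)}
    (hP : P ∈ primesOver (span {((31 : ℕ) : ℤ)}) (𝓞 F)) : Submodule.IsPrincipal P := by
  haveI : Fact (Nat.Prime 31) := ⟨by norm_num⟩
  obtain ⟨Qb, hirr, hmon, hdvd, -, hspan⟩ :=
    exists_factor_of_mem_primesOver irreducible_polyQ hα h3 isUnit_of_disc_eq_sq_mul (by norm_num : Nat.Prime 31) hP
  rw [polyMod_31] at hdvd
  rcases hirr.prime.dvd_or_dvd hdvd with h12 | h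
  · rcases hirr.prime.dvd_or_dvd h12 with h | h
    · have hirr1 : Irreducible (X + 25 : (ZMod 31)[X]) := by
        rw [show (X + 25 : (ZMod 31)[X]) = X - C (-25) by rw [map_neg, map_ofNat]; ring]
        exact irreducible_X_sub_C _
      have hQb : Qb = X + 25 := eq_of_monic_of_associated hmon (by monicity!) (hirr.associated_of_dvd hirr1 h)
      have hPeq := hspan (X + C 25) (by rw [hQb]; simp [map_ofNat])
      rw [show aeval (thetaInt hα) (X + C 25 : ℤ[X]) = thetaInt hα + 25 by
          simp only [map_add, aeval_X, aeval_C, algebraMap_int_eq, Int.coe_castRingHom, Int.cast_ofNat], Nat.cast_ofNat, span_31_lin25_eq hα] at hPeq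
      exact ⟨⟨404 + 1189 * thetaInt hα + 30 * thetaInt hα ^ 2, by rw [hPeq, Ideal.submodule_span_eq]⟩⟩
    · have hirr1 : Irreducible (X + 8 : (ZMod 31)[X]) := by
        rw [show (X + 8 : (ZMod 31)[X]) = X - C (-8) by rw [map_neg, map_ofNat]; ring]
        exact irreducible_X_sub_C _
      have hQb : Qb = X + 8 := eq_of_monic_of_associated hmon (by monicity!) (hirr.associated_of_dvd hirr1 h)
      have hPeq := hspan (X + C 8) (by rw [hQb]; simp [map_ofNat])
      rw [show aeval (thetaInt hα) (X + C 8 : ℤ[X]) = thetaInt hα + 8 by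
          simp only [map_add, aeval_X, aeval_C, algebraMap_int_eq, Int.coe_castRingHom, Int.cast_ofNat], Nat.cast_ofNat, span_31_lin8_eq hα] at hPeq
      exact ⟨⟨-1 - 4 * thetaInt hα, by rw [hPeq, Ideal.submodule_span_eq]⟩⟩
  · have hirr1 : Irreducible (X + 7 : (ZMod 31)[X]) := by
      rw [show (X + 7 : (ZMod 31)[X]) = X - C (-7) by rw [map_neg, map_ofNat]; ring]
      exact irreducible_X_sub_C _
    have hQb : Qb = X + 7 := eq_of_monic_of_associated hmon (by monicity!) (hirr.associated_of_dvd hirr1 h)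
    have hPeq := hspan (X + C 7) (by rw [hQb]; simp [map_ofNat])
    rw [show aeval (thetaInt hα) (X + C 7 : ℤ[X]) = thetaInt hα + 7 by
        simp only [map_add, aeval_X, aeval_C, algebraMap_int_eq, Int.coe_castRingHom, Int.cast_ofNat], Nat.cast_ofNat, span_31_lin7_eq hα] at hPeq
    exact ⟨⟨14 + 40 * thetaInt hα + thetaInt hα ^ 2, by rw [hPeq, Ideal.submodule_span_eq]⟩⟩

/-! ## §4 Class number one -/

/-- **`𝓞_F` is a principal ideal domain.**  Minkowski: every ideal class contains an ideal of norm
`≤ (4/π)(6/27)√13283 < 33`, and the primes `P` above `p ≤ 32` with `p^f ≤ 32` are principal (§3).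
[cite: LMFDB, number field 3.1.13283.1 (class number 1)] [cite: Marcus2018, Ch. 5, Thm. 37 and Cor. 2] -/
theorem isPrincipalIdealRing (h3 : finrank ℚ F = 3) (hα : aeval α (poly (40) (28) (5)) = 0) : IsPrincipalIdealRing (𝓞 F) := by
  apply RingOfIntegers.isPrincipalIdealRing_of_isPrincipal_of_pow_le_of_mem_primesOver_of_mem_Icc
  rw [nrComplexPlaces_eq_one h3 hα, h3, discr_eq h3 hα]
  intro p hp hpr P hP hle
  obtain ⟨hp1, hpM⟩ := Finset.mem_Icc.mp hp
  have hreal : (4 / π) ^ 1 * ((((3 : ℕ).factorial : ℕ) : ℝ) / ((3 : ℕ) : ℝ) ^ (3 : ℕ) * √|((-13283 : ℤ) : ℝ)|) < ((33 : ℕ) : ℝ) := by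
    have hπ := Real.pi_gt_d2
    have hπ0 := Real.pi_pos
    have hs : √(13283 : ℝ) < 115.26 := by
      rw [Real.sqrt_lt' (by norm_num)]; norm_num
    have hs0 : 0 ≤ √(13283 : ℝ) := Real.sqrt_nonneg _
    have habs : |((-13283 : ℤ) : ℝ)| = 13283 := by norm_num
    rw [habs]
    norm_num [Nat.factorial]
    rw [div_mul_eq_mul_div, div_lt_iff₀ hπ0]
    nlinarith
  have hfl := Nat.lt_succ_iff.mp ((Nat.floor_lt' (by norm_num)).mpr hreal)
  have hpB : p ≤ 32 := hpM.trans hfl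
  have hleB : p ^ P.inertiaDeg ℤ ≤ 32 := hle.trans hfl
  clear hpM hle hp
  interval_cases p
  · exact absurd hpr (by norm_num)
  · exact isPrincipal_of_mem_primesOver_2 h3 hα hP
  · exact isPrincipal_of_mem_primesOver_3 h3 hα hP
  · exact absurd hpr (by norm_num)
  · exact isPrincipal_of_mem_primesOver_5 h3 hα hP
  · exact absurd hpr (by norm_num)
  · exact isPrincipal_of_mem_primesOver_7 h3 hα hP hleB
  · exact absurd hpr (by norm_num)
  · exact absurd hpr (by norm_num)
  · exact absurd hpr (by norm_num)
  · exact isPrincipal_of_mem_primesOver_11 h3 hα hP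
  · exact absurd hpr (by norm_num)
  · exact isPrincipal_of_mem_primesOver_13 h3 hα hP
  · exact absurd hpr (by norm_num)
  · exact absurd hpr (by norm_num)
  · exact absurd hpr (by norm_num)
  · exact isPrincipal_of_mem_primesOver_17 h3 hα hP hleB
  · exact absurd hpr (by norm_num)
  · exact isPrincipal_of_mem_primesOver_19 h3 hα hP
  · exact absurd hpr (by norm_num)
  · exact absurd hpr (by norm_num)
  · exact absurd hpr (by norm_num)
  · exact isPrincipal_of_mem_primesOver_23 h3 hα hP hleB
  · exact absurd hpr (by norm_num)
  · exact absurd hpr (by norm_num)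
  · exact absurd hpr (by norm_num)
  · exact absurd hpr (by norm_num)
  · exact absurd hpr (by norm_num)
  · exact isPrincipal_of_mem_primesOver_29 h3 hα hP
  · exact absurd hpr (by norm_num)
  · exact isPrincipal_of_mem_primesOver_31 h3 hα hP
  · exact absurd hpr (by norm_num)

/-- ★ **`h_F = 1`: the cubic field of discriminant `−13283` has class number one.** [cite: LMFDB, number field 3.1.13283.1 (class number 1)] -/
theorem classNumber_eq_one (h3 : finrank ℚ F = 3) (hα : aeval α (poly (40) (28) (5)) = 0) : classNumber F = 1 :=
  (classNumber_eq_one_iff (K := F)).mpr (isPrincipalIdealRing h3 hα)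

/-- **`h_F` is odd** (the form consumed by the `2`-adic doors of cell `bsd-f1-sign2`). [cite: LMFDB, number field 3.1.13283.1 (class number 1)] -/
theorem not_two_dvd_classNumber (h3 : finrank ℚ F = 3) (hα : aeval α (poly (40) (28) (5)) = 0) : ¬ 2 ∣ classNumber F := by
  rw [classNumber_eq_one h3 hα]; decide

end NumberField

end Literature.NumberTheory.CubicFields.CubicDisc13283

end
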